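/-
Copyright (c) 2026. All rights reserved.
Released under Apache 2.0 license as described in the file LICENSE.
-/
import Literature.AlgebraicGeometry.ComplexMultiplication.HyperellipticJacobianLevelFortyWeilPlaneSplit
import Literature.AlgebraicGeometry.HodgeTheory.WeilClassesOfIsogenyInvariance
import Literature.AlgebraicGeometry.HodgeTheory.WeilTypeProducts
import Literature.AlgebraicGeometry.HodgeTheory.WeilClassesFourfoldsProofs
import Literature.AlgebraicGeometry.Motives.AbelianVarietyPoincareCompleteReducibility
import HarnessLib

/-!
# `J_{40}`: the PRODUCT MODEL `Z′ = Y_{40} × (E′ × E′)` of the sixfold `Z = E′ ⊕ E′ ⊕ Y_{40}` — an explicit `ℚ(√−2)`-equivariant isomorphism, Weil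
# type `(3, 2)` of `(Z′, φ_Y × (ψ × ψ))`, and the transport of the Weil-plane statement; `HC(J_{40})` GIVEN Markman's fact and the split datum on the
# product model (where the tree's Segre ∕ discriminant-of-products lemmas apply)

Layer `Literature/AlgebraicGeometry/ComplexMultiplication`, namespace `…HyperellipticJacobian.WeightedForty`; the sequel of
`HyperellipticJacobianLevelFortyWeilPlaneSplit` (F58e: `HC(J_{40})` GIVEN `Markman2025_weilClasses_algebraic_hyperbolicSixfold` and
`IsSplitWeilType Z φ_a 3 2`).  THEOREMS ONLY (no definition, no named fact, no `sorry`; D-0026 net debt `0`).  PURPOSE: the split datum will be computed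
(next generation) with the tree's PRODUCT lemmas — `Motives.exists_symmetricSegreEmbedding` (a `K`-symmetric Segre embedding of `A × (E × E)` with
prescribed weights on the two curves) and `VanGeemen1994.hasWeilDiscriminantNondeg_prod_of_kFrames` (the discriminant is multiplicative) — which speak
about `Motives.AbelianVariety.prod`, not about the biproduct `⨁_{j<3} B_{(0,0,1) j}` of F58c∕F58d.  This file moves the whole statement to the product
model once and for all.

## What is proved (pair setting of F58c: `E′ = B_0 ⊨ (L_8; Ψ_8)`, `Y_{40} = B_1 ⊨ (L_{40}; Ψ_{40})`, `a = (a_0, a_1)`, `a_i² = −2`)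

* `prodModel_sq_eq` — `Ψ′ ≫ Ψ′ = −2` for `Ψ′ = φ_Y × (ψ × ψ)` on `Z′ = B_1 × (B_0 × B_0)`
  (`φ_Y = ι(a_1)`, `ψ = ι(a_0)`).
* **`exists_prodModel_isIsogeny_comm`** — an ISOGENY (indeed an isomorphism) `f : Z′ ⟶ Z = ⨁_{j<3} B_{(0,0,1) j}` with `f ≫ φ_a = Ψ′ ≫ f`
  (`f = biproduct.lift (snd ≫ fst, snd ≫ snd, fst)`, inverse `prodLift (π_2, prodLift (π_0, π_1))`).
* **`isWeilType_prodModel`** — `(Z′, Ψ′)` is of Weil type `(3, 2)` (transport of F58c's `isWeilType_sixfold`, `IsWeilType.of_isIsogeny'`).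
* **`weilClasses_algebraic_prodModel_iff`** — the rational `(3,3)` classes of the Weil plane of `(Z′, Ψ′)` are algebraic IFF those of `(Z, φ_a)` are
  (van Geemen 3.6–3.7 on the Weil plane, the tree's `forall_mem_algebraicClasses_weilClassesOf_iff_of_isIsogeny_of_comm`).
* **`weilClasses_sixfold_algebraic_of_markman_of_isSplitWeilType_prodModel`** — GIVEN Markman's fact (by name) and `IsSplitWeilType Z′ Ψ′ 3 2`, the
  hypothesis `hW` of F58c∕F58d holds; hence **`hodgeConjectureFor_prod_of_markman_of_isSplitWeilType_prodModel`** (`HC(E′^a × Y_{40}^c)` for all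
  `a, c`) and, on the `J_{40}`-family of F58d §4, **`hodgeConjectureFor_biproduct_forty_of_markman_of_isSplitWeilType_prodModel`** (`HC(J_{40})`) and
  **`hodgeConjectureFor_of_isIsogenous_prod_forty_of_markman_of_isSplitWeilType_prodModel`** (every product of the CM pieces).

HONEST REGISTER.  Conditional on Markman's PREPRINT theorem and on the split datum for the product model, neither of which is asserted; the split
datum is the g59 target (roadmap: g58 DELIVERABLE §5).  HC_CM is NOT proved.

## References

* [Markman2025SecantWeil] E. Markman, arXiv:2502.03415 (2025) — Thm. 1.5.1. [cite: Markman2025SecantWeil, Thm. 1.5.1]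
* [Markman2025SurveySecant] E. Markman, arXiv:2509.23403 (2025) — Thm. 1.2, §11.5 Steps 1–2. [cite: Markman2025SurveySecant, §11.5 Steps 1–2]
* [vanGeemen1994HodgeAV] B. van Geemen, LNM 1594 (1994) — 3.6, Lemma 3.7, 4.9, Lemma 5.2, 5.4. [cite: vanGeemen1994HodgeAV, 3.6 and Lemma 3.7]
* [MoonenZarhin1999LowDim] B. Moonen, Yu. Zarhin, Math. Ann. 315 (1999) — §5 Case 2. [cite: MoonenZarhin1999LowDim, §5 Case 2]
* [MumfordAV1970] D. Mumford, *Abelian Varieties* — §19 (Remark p. 169, Thm. 1). [cite: MumfordAV1970, §19 Remark p. 169]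
* [GalleseGoodsonLombardo2024] A. Gallese, H. Goodson, D. Lombardo, arXiv:2405.20394 — §3 Thm. 3.0, §3.5. [cite: GalleseGoodsonLombardo2024, §3 Thm. 3.0 (5)]

## Provenance

Cell `pub-hodgecm2` (COR-CM), KEPT Literature lane `lit-deligne-3` gen 58 (claim MZ99-J40-PRODUCT-MODEL; count-neutral, own lane), file F58f.
-/

noncomputable section

open CategoryTheory CategoryTheory.Limits NumberField Module

namespace Literature.AlgebraicGeometry.ComplexMultiplication

open Literature.AlgebraicGeometry.Motives
open Literature.AlgebraicGeometry.Motives.AbelianVariety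
open Literature.AlgebraicTopology.SingularHomology
open Literature.AlgebraicGeometry.HodgeTheory (complexBetti IsRationalClass IsOfHodgeType HodgeConjectureFor IsWeilType IsSplitWeilType weilClassesOf
  algebraicClasses IsStablyNondegenerate Markman2025_weilClasses_algebraic_hyperbolicSixfold prodLift_comp_self_eq_neg_nsmul
  forall_mem_algebraicClasses_weilClassesOf_iff_of_isIsogeny_of_comm)
open Literature.NumberTheory.ComplexMultiplication
open Literature.AlgebraicGeometry.ComplexMultiplication.CMWeights

namespace HyperellipticJacobian

namespace WeightedForty

open Literature.AlgebraicGeometry.Pohlmann1968 Literature.AlgebraicGeometry.Pohlmann1968.Cyclotomic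
open Literature.AlgebraicGeometry.Pohlmann1968.CMAlgebra

open scoped Classical

section ProductModel

variable {lev : Fin 2 → ℕ} [∀ i, NeZero (lev i)] {K : Fin 2 → Type} [∀ i, Field (K i)] [∀ i, NumberField (K i)]
  [∀ i, IsCyclotomicExtension {lev i} ℚ (K i)] {Φ : ∀ i, CMType (K i)}
  {L : ∀ i, IntermediateField ℚ (K i)} {Ψ : ∀ i, CMType (L i)}
  {B : Fin 2 → AbelianVariety ℂ} {ιB : ∀ i, 𝓞 (L i) →+* End (B i)} {θB : ∀ i, L i →+* Module.End ℂ (complexBetti (B i).X 1)}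

omit [∀ i, NeZero (lev i)] [∀ i, IsCyclotomicExtension {lev i} ℚ (K i)] in
/-- `ι(a_i) ≫ ι(a_i) = −2` on `B_i` when `a_i² = −2` in `𝓞_{L_i}`. [folklore] -/
private theorem comp_self_member_eq_neg (a : ∀ i, 𝓞 (L i)) (ha2 : ∀ i, a i * a i = -((2 : ℕ) : 𝓞 (L i))) (i : Fin 2) :
    ιB i (a i) ≫ ιB i (a i) = -((2 : ℕ) • 𝟙 (B i)) := by
  rw [← End.mul_def, ← map_mul, ha2 i, map_neg, map_natCast, ← nsmul_one 2]
  rfl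

omit [∀ i, NeZero (lev i)] [∀ i, IsCyclotomicExtension {lev i} ℚ (K i)] in
/-- **`Ψ′ ≫ Ψ′ = −2` on the product model `Z′ = Y_{40} × (E′ × E′)`**, `Ψ′ = ι(a_1) × (ι(a_0) × ι(a_0))`. [cite: vanGeemen1994HodgeAV, 4.9 and 5.2] -/
theorem prodModel_sq_eq (a : ∀ i, 𝓞 (L i)) (ha2 : ∀ i, a i * a i = -((2 : ℕ) : 𝓞 (L i))) :
    prodLift (fst (B 1) ((B 0).prod (B 0)) ≫ ιB 1 (a 1))
        (snd (B 1) ((B 0).prod (B 0)) ≫ prodLift (fst (B 0) (B 0) ≫ ιB 0 (a 0)) (snd (B 0) (B 0) ≫ ιB 0 (a 0))) ≫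
      prodLift (fst (B 1) ((B 0).prod (B 0)) ≫ ιB 1 (a 1))
        (snd (B 1) ((B 0).prod (B 0)) ≫ prodLift (fst (B 0) (B 0) ≫ ιB 0 (a 0)) (snd (B 0) (B 0) ≫ ιB 0 (a 0))) =
      -((2 : ℕ) • 𝟙 ((B 1).prod ((B 0).prod (B 0)))) :=
  prodLift_comp_self_eq_neg_nsmul (comp_self_member_eq_neg a ha2 1)
    (prodLift_comp_self_eq_neg_nsmul (comp_self_member_eq_neg a ha2 0) (comp_self_member_eq_neg a ha2 0))

omit [∀ i, NeZero (lev i)] [∀ i, IsCyclotomicExtension {lev i} ℚ (K i)] in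
/-- **THE PRODUCT MODEL IS `K`-EQUIVARIANTLY ISOMORPHIC TO `Z`**: there is an isogeny (indeed an isomorphism) `f : Y_{40} × (E′ × E′) ⟶ Z = E′ ⊕ E′ ⊕ Y_{40}`
with `f ≫ φ_a = Ψ′ ≫ f` — `f = biproduct.lift (snd ≫ fst, snd ≫ snd, fst)`, inverse `(π_2, (π_0, π_1))`. [cite: MumfordAV1970, §19 Remark p. 169]
[cite: vanGeemen1994HodgeAV, 3.6] -/
theorem exists_prodModel_isIsogeny_comm (a : ∀ i, 𝓞 (L i)) :
    ∃ f : (B 1).prod ((B 0).prod (B 0)) ⟶ (⨁ fun j : Fin 3 => B ((![0, 0, 1] : Fin 3 → Fin 2) j)),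
      IsIsogeny f ∧
        f ≫ (biproduct.map fun j : Fin 3 => ιB ((![0, 0, 1] : Fin 3 → Fin 2) j) (a ((![0, 0, 1] : Fin 3 → Fin 2) j))) =
          prodLift (fst (B 1) ((B 0).prod (B 0)) ≫ ιB 1 (a 1))
              (snd (B 1) ((B 0).prod (B 0)) ≫ prodLift (fst (B 0) (B 0) ≫ ιB 0 (a 0)) (snd (B 0) (B 0) ≫ ιB 0 (a 0))) ≫ f := by
  -- the components of `f`
  obtain ⟨g, hg0, hg1, hg2⟩ : ∃ g : ∀ j : Fin 3, (B 1).prod ((B 0).prod (B 0)) ⟶ B ((![0, 0, 1] : Fin 3 → Fin 2) j),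
      g 0 = snd (B 1) ((B 0).prod (B 0)) ≫ fst (B 0) (B 0) ∧ g 1 = snd (B 1) ((B 0).prod (B 0)) ≫ snd (B 0) (B 0) ∧
        g 2 = fst (B 1) ((B 0).prod (B 0)) :=
    ⟨Fin.cases (motive := fun j : Fin 3 => (B 1).prod ((B 0).prod (B 0)) ⟶ B ((![0, 0, 1] : Fin 3 → Fin 2) j))
        (snd (B 1) ((B 0).prod (B 0)) ≫ fst (B 0) (B 0))
        (Fin.cases (motive := fun j : Fin 2 => (B 1).prod ((B 0).prod (B 0)) ⟶ B ((![0, 0, 1] : Fin 3 → Fin 2) j.succ))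
          (snd (B 1) ((B 0).prod (B 0)) ≫ snd (B 0) (B 0))
          (Fin.cases (motive := fun j : Fin 1 => (B 1).prod ((B 0).prod (B 0)) ⟶ B ((![0, 0, 1] : Fin 3 → Fin 2) j.succ.succ))
            (fst (B 1) ((B 0).prod (B 0))) (fun i => i.elim0))),
      rfl, rfl, rfl⟩
  have hπ : ∀ j, biproduct.lift g ≫ biproduct.π _ j = g j := fun j => biproduct.lift_π g j
  -- the inverse `(π_2, (π_0, π_1))`
  obtain ⟨h, hh1, hh2, hh3⟩ : ∃ h : (⨁ fun j : Fin 3 => B ((![0, 0, 1] : Fin 3 → Fin 2) j)) ⟶ (B 1).prod ((B 0).prod (B 0)),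
      h ≫ fst (B 1) ((B 0).prod (B 0)) = biproduct.π (fun j : Fin 3 => B ((![0, 0, 1] : Fin 3 → Fin 2) j)) 2 ∧
      h ≫ snd (B 1) ((B 0).prod (B 0)) ≫ fst (B 0) (B 0) = biproduct.π (fun j : Fin 3 => B ((![0, 0, 1] : Fin 3 → Fin 2) j)) 0 ∧
      h ≫ snd (B 1) ((B 0).prod (B 0)) ≫ snd (B 0) (B 0) = biproduct.π (fun j : Fin 3 => B ((![0, 0, 1] : Fin 3 → Fin 2) j)) 1 :=
    ⟨prodLift (biproduct.π (fun j : Fin 3 => B ((![0, 0, 1] : Fin 3 → Fin 2) j)) 2)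
        (prodLift (biproduct.π (fun j : Fin 3 => B ((![0, 0, 1] : Fin 3 → Fin 2) j)) 0)
          (biproduct.π (fun j : Fin 3 => B ((![0, 0, 1] : Fin 3 → Fin 2) j)) 1)),
      prodLift_fst _ _, by rw [prodLift_snd_assoc, prodLift_fst], by rw [prodLift_snd_assoc, prodLift_snd]⟩
  -- (the slot objects `B (![0, 0, 1] j)` and `B 0`, `B 1` agree only up to unfolding, so the component equations are bridged by `exact`)
  have hfh : biproduct.lift g ≫ h = 𝟙 _ := by
    refine prod_hom_ext ?_ (prod_hom_ext ?_ ?_)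
    · simp only [Category.assoc, hh1, Category.id_comp]
      exact (hπ 2).trans hg2
    · simp only [Category.assoc, hh2, Category.id_comp]
      exact (hπ 0).trans hg0
    · simp only [Category.assoc, hh3, Category.id_comp]
      exact (hπ 1).trans hg1
  have hhf : h ≫ biproduct.lift g = 𝟙 _ := by
    refine biproduct.hom_ext _ _ fun j => ?_
    simp only [Category.assoc, hπ, Category.id_comp]
    refine Fin.cases ?_ (Fin.cases ?_ (Fin.cases ?_ (fun i => i.elim0))) j
    · show h ≫ g 0 = biproduct.π _ 0
      rw [hg0]
      exact hh2
    · show h ≫ g 1 = biproduct.π _ 1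
      rw [hg1]
      exact hh3
    · show h ≫ g 2 = biproduct.π _ 2
      rw [hg2]
      exact hh1
  refine ⟨biproduct.lift g, isIsogeny_hom_of_iso ⟨biproduct.lift g, h, hfh, hhf⟩, ?_⟩
  -- equivariance, slot by slot
  have e0 : (snd (B 1) ((B 0).prod (B 0)) ≫ fst (B 0) (B 0)) ≫ ιB 0 (a 0) =
      prodLift (fst (B 1) ((B 0).prod (B 0)) ≫ ιB 1 (a 1))
          (snd (B 1) ((B 0).prod (B 0)) ≫ prodLift (fst (B 0) (B 0) ≫ ιB 0 (a 0)) (snd (B 0) (B 0) ≫ ιB 0 (a 0))) ≫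
        snd (B 1) ((B 0).prod (B 0)) ≫ fst (B 0) (B 0) := by
    simp only [Category.assoc, prodLift_snd_assoc, prodLift_fst]
  have e1 : (snd (B 1) ((B 0).prod (B 0)) ≫ snd (B 0) (B 0)) ≫ ιB 0 (a 0) =
      prodLift (fst (B 1) ((B 0).prod (B 0)) ≫ ιB 1 (a 1))
          (snd (B 1) ((B 0).prod (B 0)) ≫ prodLift (fst (B 0) (B 0) ≫ ιB 0 (a 0)) (snd (B 0) (B 0) ≫ ιB 0 (a 0))) ≫
        snd (B 1) ((B 0).prod (B 0)) ≫ snd (B 0) (B 0) := by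
    simp only [Category.assoc, prodLift_snd_assoc, prodLift_snd]
  have e2 : fst (B 1) ((B 0).prod (B 0)) ≫ ιB 1 (a 1) =
      prodLift (fst (B 1) ((B 0).prod (B 0)) ≫ ιB 1 (a 1))
          (snd (B 1) ((B 0).prod (B 0)) ≫ prodLift (fst (B 0) (B 0) ≫ ιB 0 (a 0)) (snd (B 0) (B 0) ≫ ιB 0 (a 0))) ≫
        fst (B 1) ((B 0).prod (B 0)) := by
    rw [prodLift_fst]
  refine biproduct.hom_ext _ _ fun j => ?_
  simp only [Category.assoc, biproduct.map_π, biproduct.lift_π_assoc, hπ]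
  refine Fin.cases ?_ (Fin.cases ?_ (Fin.cases ?_ (fun i => i.elim0))) j
  · show g 0 ≫ ιB 0 (a 0) = _ ≫ g 0
    rw [hg0]
    exact e0
  · show g 1 ≫ ιB 0 (a 0) = _ ≫ g 1
    rw [hg1]
    exact e1
  · show g 2 ≫ ιB 1 (a 1) = _ ≫ g 2
    rw [hg2]
    exact e2

/-- **THE PRODUCT MODEL `(Y_{40} × (E′ × E′), ι(a_1) × (ι(a_0) × ι(a_0)))` IS OF WEIL TYPE `(3, 2)`** (transport of F58c's `isWeilType_sixfold` along the
`K`-equivariant isomorphism; van Geemen: Weil type is isogeny-invariant). [cite: vanGeemen1994HodgeAV, 4.9 and proof of Lemma 5.2] [cite: MoonenZarhin1999LowDim, §5 Case 2] -/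
theorem isWeilType_prodModel (h0 : lev 0 = 8) (h1 : lev 1 = 40)
    (hΦ : ∀ i (σ : K i →+* ℂ), σ ∈ (Φ i).1 ↔ 2 * (expOf (lev i) (K i) σ).val < lev i)
    (hind : ∀ i, inducedCMType (algebraMap (L i) (K i)) (Ψ i) = Φ i) (hfin : ∀ i, Module.finrank (L i) (K i) = 2) (a : ∀ i, 𝓞 (L i))
    (ha : ∀ i, (((a i : L i)) : K i) = zetaOf (lev i) (K i) ^ ((![7, 5] : Fin 2 → ℕ) i) - (zetaOf (lev i) (K i) ^ ((![7, 5] : Fin 2 → ℕ) i))⁻¹)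
    (hB : ∀ i, IsCMTypeRealisation (Ψ i) (B i) (ιB i) (θB i)) :
    IsWeilType ((B 1).prod ((B 0).prod (B 0)))
      (prodLift (fst (B 1) ((B 0).prod (B 0)) ≫ ιB 1 (a 1))
        (snd (B 1) ((B 0).prod (B 0)) ≫ prodLift (fst (B 0) (B 0) ≫ ιB 0 (a 0)) (snd (B 0) (B 0) ≫ ιB 0 (a 0)))) 3 2 := by
  obtain ⟨f, hf, hcomm⟩ := exists_prodModel_isIsogeny_comm (B := B) (ιB := ιB) a
  exact (isWeilType_sixfold h0 h1 hΦ hind hfin a ha hB).of_isIsogeny' f hf hcomm (prodModel_sq_eq a (WeilPlaneForty.sq_a_eq h0 h1 a ha))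

/-- **THE WEIL-PLANE STATEMENT MOVES TO THE PRODUCT MODEL**: the rational `(3,3)` classes of the Weil plane of `(Y_{40} × (E′ × E′), Ψ′)` are algebraic
IFF those of `(Z, φ_a)` are (van Geemen 3.6–3.7 applied to the `K`-equivariant isomorphism). [cite: vanGeemen1994HodgeAV, 3.6 and Lemma 3.7]
[cite: MumfordAV1970, §19 Remark p. 169] -/
theorem weilClasses_algebraic_prodModel_iff (h0 : lev 0 = 8) (h1 : lev 1 = 40)
    (hΦ : ∀ i (σ : K i →+* ℂ), σ ∈ (Φ i).1 ↔ 2 * (expOf (lev i) (K i) σ).val < lev i)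
    (hind : ∀ i, inducedCMType (algebraMap (L i) (K i)) (Ψ i) = Φ i) (hfin : ∀ i, Module.finrank (L i) (K i) = 2) (a : ∀ i, 𝓞 (L i))
    (ha : ∀ i, (((a i : L i)) : K i) = zetaOf (lev i) (K i) ^ ((![7, 5] : Fin 2 → ℕ) i) - (zetaOf (lev i) (K i) ^ ((![7, 5] : Fin 2 → ℕ) i))⁻¹)
    (hB : ∀ i, IsCMTypeRealisation (Ψ i) (B i) (ιB i) (θB i)) :
    (∀ c ∈ weilClassesOf ((B 1).prod ((B 0).prod (B 0)))
        (prodLift (fst (B 1) ((B 0).prod (B 0)) ≫ ιB 1 (a 1))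
          (snd (B 1) ((B 0).prod (B 0)) ≫ prodLift (fst (B 0) (B 0) ≫ ιB 0 (a 0)) (snd (B 0) (B 0) ≫ ιB 0 (a 0)))) 3 2,
      IsRationalClass c → IsOfHodgeType (2 * 3) ((B 1).prod ((B 0).prod (B 0))).X (2 * 3) 3 3 c →
        c ∈ algebraicClasses ((B 1).prod ((B 0).prod (B 0))).X 3) ↔
    ∀ c ∈ weilClassesOf (⨁ fun j : Fin 3 => B ((![0, 0, 1] : Fin 3 → Fin 2) j))
        (biproduct.map fun j : Fin 3 => ιB ((![0, 0, 1] : Fin 3 → Fin 2) j) (a ((![0, 0, 1] : Fin 3 → Fin 2) j))) 3 2,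
      IsRationalClass c → IsOfHodgeType (2 * 3) (⨁ fun j : Fin 3 => B ((![0, 0, 1] : Fin 3 → Fin 2) j)).X (2 * 3) 3 3 c →
        c ∈ algebraicClasses (⨁ fun j : Fin 3 => B ((![0, 0, 1] : Fin 3 → Fin 2) j)).X 3 := by
  obtain ⟨f, hf, hcomm⟩ := exists_prodModel_isIsogeny_comm (B := B) (ιB := ιB) a
  have hZ := isWeilType_sixfold h0 h1 hΦ hind hfin a ha hB
  have hZ' := isWeilType_prodModel h0 h1 hΦ hind hfin a ha hB
  have key := forall_mem_algebraicClasses_weilClassesOf_iff_of_isIsogeny_of_comm hf hcomm 3 2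
  rw [hZ.dim_eq, hZ'.dim_eq] at key
  exact key

/-- **THE WEIL PLANE OF `Z` GIVEN MARKMAN'S FACT AND THE SPLIT DATUM ON THE PRODUCT MODEL**: if `(Y_{40} × (E′ × E′), Ψ′)` is of split Weil type
(`IsSplitWeilType … 3 2`), Markman's theorem (by name) makes its rational `(3,3)` Weil classes algebraic, hence those of `(Z, φ_a)` — the hypothesis
`hW` of F58c∕F58d. [cite: Markman2025SecantWeil, Thm. 1.5.1] [cite: vanGeemen1994HodgeAV, 3.6, Lemma 3.7 and 5.4] [cite: MoonenZarhin1999LowDim, §5 Case 2] -/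
theorem weilClasses_sixfold_algebraic_of_markman_of_isSplitWeilType_prodModel (hM : Markman2025_weilClasses_algebraic_hyperbolicSixfold)
    (h0 : lev 0 = 8) (h1 : lev 1 = 40) (hΦ : ∀ i (σ : K i →+* ℂ), σ ∈ (Φ i).1 ↔ 2 * (expOf (lev i) (K i) σ).val < lev i)
    (hind : ∀ i, inducedCMType (algebraMap (L i) (K i)) (Ψ i) = Φ i) (hfin : ∀ i, Module.finrank (L i) (K i) = 2) (a : ∀ i, 𝓞 (L i))
    (ha : ∀ i, (((a i : L i)) : K i) = zetaOf (lev i) (K i) ^ ((![7, 5] : Fin 2 → ℕ) i) - (zetaOf (lev i) (K i) ^ ((![7, 5] : Fin 2 → ℕ) i))⁻¹)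
    (hB : ∀ i, IsCMTypeRealisation (Ψ i) (B i) (ιB i) (θB i))
    (hS : IsSplitWeilType ((B 1).prod ((B 0).prod (B 0)))
      (prodLift (fst (B 1) ((B 0).prod (B 0)) ≫ ιB 1 (a 1))
        (snd (B 1) ((B 0).prod (B 0)) ≫ prodLift (fst (B 0) (B 0) ≫ ιB 0 (a 0)) (snd (B 0) (B 0) ≫ ιB 0 (a 0)))) 3 2) :
    ∀ c ∈ weilClassesOf (⨁ fun j : Fin 3 => B ((![0, 0, 1] : Fin 3 → Fin 2) j))
        (biproduct.map fun j : Fin 3 => ιB ((![0, 0, 1] : Fin 3 → Fin 2) j) (a ((![0, 0, 1] : Fin 3 → Fin 2) j))) 3 2,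
      IsRationalClass c → IsOfHodgeType (2 * 3) (⨁ fun j : Fin 3 => B ((![0, 0, 1] : Fin 3 → Fin 2) j)).X (2 * 3) 3 3 c →
        c ∈ algebraicClasses (⨁ fun j : Fin 3 => B ((![0, 0, 1] : Fin 3 → Fin 2) j)).X 3 :=
  (weilClasses_algebraic_prodModel_iff h0 h1 hΦ hind hfin a ha hB).1 (weilClasses_algebraic_of_markman_of_isSplitWeilType hM hS)

/-- **`HC(E′^a × Y_{40}^c)` FOR ALL `a, c`, GIVEN MARKMAN'S FACT AND THE SPLIT DATUM ON THE PRODUCT MODEL.** [cite: MoonenZarhin1999LowDim, Thm. 0.2 (3) and §5 Case 2]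
[cite: Markman2025SecantWeil, Thm. 1.5.1] -/
theorem hodgeConjectureFor_prod_of_markman_of_isSplitWeilType_prodModel (hM : Markman2025_weilClasses_algebraic_hyperbolicSixfold)
    (h0 : lev 0 = 8) (h1 : lev 1 = 40) (hΦ : ∀ i (σ : K i →+* ℂ), σ ∈ (Φ i).1 ↔ 2 * (expOf (lev i) (K i) σ).val < lev i)
    (hind : ∀ i, inducedCMType (algebraMap (L i) (K i)) (Ψ i) = Φ i) (hfin : ∀ i, Module.finrank (L i) (K i) = 2) (a : ∀ i, 𝓞 (L i))
    (ha : ∀ i, (((a i : L i)) : K i) = zetaOf (lev i) (K i) ^ ((![7, 5] : Fin 2 → ℕ) i) - (zetaOf (lev i) (K i) ^ ((![7, 5] : Fin 2 → ℕ) i))⁻¹)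
    (hB : ∀ i, IsCMTypeRealisation (Ψ i) (B i) (ιB i) (θB i)) (hs : (B 1).IsSimple) (hst : IsStablyNondegenerate (B 1))
    (hS : IsSplitWeilType ((B 1).prod ((B 0).prod (B 0)))
      (prodLift (fst (B 1) ((B 0).prod (B 0)) ≫ ιB 1 (a 1))
        (snd (B 1) ((B 0).prod (B 0)) ≫ prodLift (fst (B 0) (B 0) ≫ ιB 0 (a 0)) (snd (B 0) (B 0) ≫ ιB 0 (a 0)))) 3 2)
    (N : ℕ) (π : Fin N → Fin 2) : HodgeConjectureFor (⨁ fun j => B (π j)).dim (⨁ fun j => B (π j)).X :=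
  hodgeConjectureFor_prod_of_weilClasses_algebraic h0 h1 hΦ hind hfin a ha hB hs hst
    (weilClasses_sixfold_algebraic_of_markman_of_isSplitWeilType_prodModel hM h0 h1 hΦ hind hfin a ha hB hS) N π

end ProductModel

/-! ## The `J_{40}`-family, given Markman's fact and the split datum on the product model -/

section Family

variable {κ : Type} {lev : κ → ℕ} [∀ j, NeZero (lev j)] {F : κ → Type} [∀ j, Field (F j)] [∀ j, NumberField (F j)]
  [∀ j, IsCyclotomicExtension {lev j} ℚ (F j)] {Λ : ∀ j, CMType (F j)} {C : κ → AbelianVariety ℂ}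
  {ιC : ∀ j, 𝓞 (F j) →+* End (C j)} {θC : ∀ j, F j →+* Module.End ℂ (complexBetti (C j).X 1)}
  {v : Fin 2 → κ} {L : ∀ i, IntermediateField ℚ (F (v i))} {Ψ : ∀ i, CMType (L i)} {B : Fin 2 → AbelianVariety ℂ}
  {ιB : ∀ i, 𝓞 (L i) →+* End (B i)} {θB : ∀ i, L i →+* Module.End ℂ (complexBetti (B i).X 1)}

/-- **`HC(J(y² = x^{40} − 1))` GIVEN MARKMAN'S FACT AND THE SPLIT DATUM ON `Y_{40} × (E′ × E′)`.** [cite: GalleseGoodsonLombardo2024, §3 Thm. 3.0 (5)]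
[cite: Markman2025SecantWeil, Thm. 1.5.1] [cite: MoonenZarhin1999LowDim, §5 Case 2] -/
theorem hodgeConjectureFor_biproduct_forty_of_markman_of_isSplitWeilType_prodModel [Fintype κ] [DecidableEq κ]
    (hM : Markman2025_weilClasses_algebraic_hyperbolicSixfold) (hlev : ∀ d, (∃ j, lev j = d) ↔ d ∣ 40 ∧ 3 ≤ d) (hinj : Function.Injective lev)
    (hΛ : ∀ j (σ : F j →+* ℂ), σ ∈ (Λ j).1 ↔ 2 * (expOf (lev j) (F j) σ).val < lev j) (hC : ∀ j, IsCMTypeRealisation (Λ j) (C j) (ιC j) (θC j))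
    (hv0 : lev (v 0) = 8) (hv1 : lev (v 1) = 40) (hind : ∀ i, inducedCMType (algebraMap (L i) (F (v i))) (Ψ i) = Λ (v i))
    (hfin : ∀ i, Module.finrank (L i) (F (v i)) = 2) (hB : ∀ i, IsCMTypeRealisation (Ψ i) (B i) (ιB i) (θB i)) (hs : (B 1).IsSimple)
    (hst : IsStablyNondegenerate (B 1)) (hiso : ∀ i, IsIsogenous (C (v i)) (⨁ fun _ : Fin 2 => B i)) (a : ∀ i, 𝓞 (L i))
    (ha : ∀ i, (((a i : L i)) : F (v i)) =
      zetaOf (lev (v i)) (F (v i)) ^ ((![7, 5] : Fin 2 → ℕ) i) - (zetaOf (lev (v i)) (F (v i)) ^ ((![7, 5] : Fin 2 → ℕ) i))⁻¹)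
    (h8 : ∀ j, lev j = 8 → j = v 0) (h40 : ∀ j, lev j = 40 → j = v 1)
    (hS : IsSplitWeilType ((B 1).prod ((B 0).prod (B 0)))
      (prodLift (fst (B 1) ((B 0).prod (B 0)) ≫ ιB 1 (a 1))
        (snd (B 1) ((B 0).prod (B 0)) ≫ prodLift (fst (B 0) (B 0) ≫ ιB 0 (a 0)) (snd (B 0) (B 0) ≫ ιB 0 (a 0)))) 3 2) :
    HodgeConjectureFor (⨁ C).dim (⨁ C).X :=
  (hodgeConjectureFor_biproduct_forty_iff hlev hinj hΛ hC hv0 hv1 hind hfin hB hs hst hiso a ha h8 h40).2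
    (weilClasses_sixfold_algebraic_of_markman_of_isSplitWeilType_prodModel (lev := fun i => lev (v i)) (K := fun i => F (v i))
      (Φ := fun i => Λ (v i)) hM hv0 hv1 (fun i σ => hΛ (v i) σ) hind hfin a ha hB hS)

/-- **… and HC for every `X` isogenous to a product of the CM pieces of `J_{40}`, given the same.** [cite: GalleseGoodsonLombardo2024, §3 Thm. 3.0 and §3.5]
[cite: Markman2025SecantWeil, Thm. 1.5.1] [cite: MoonenZarhin1999LowDim, §3 (3.1) and §5 Case 2] -/
theorem hodgeConjectureFor_of_isIsogenous_prod_forty_of_markman_of_isSplitWeilType_prodModel [Fintype κ] [DecidableEq κ]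
    (hM : Markman2025_weilClasses_algebraic_hyperbolicSixfold) (hlev : ∀ d, (∃ j, lev j = d) ↔ d ∣ 40 ∧ 3 ≤ d) (hinj : Function.Injective lev)
    (hΛ : ∀ j (σ : F j →+* ℂ), σ ∈ (Λ j).1 ↔ 2 * (expOf (lev j) (F j) σ).val < lev j) (hC : ∀ j, IsCMTypeRealisation (Λ j) (C j) (ιC j) (θC j))
    (hv0 : lev (v 0) = 8) (hv1 : lev (v 1) = 40) (hind : ∀ i, inducedCMType (algebraMap (L i) (F (v i))) (Ψ i) = Λ (v i))
    (hfin : ∀ i, Module.finrank (L i) (F (v i)) = 2) (hB : ∀ i, IsCMTypeRealisation (Ψ i) (B i) (ιB i) (θB i)) (hs : (B 1).IsSimple)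
    (hst : IsStablyNondegenerate (B 1)) (hiso : ∀ i, IsIsogenous (C (v i)) (⨁ fun _ : Fin 2 => B i)) (a : ∀ i, 𝓞 (L i))
    (ha : ∀ i, (((a i : L i)) : F (v i)) =
      zetaOf (lev (v i)) (F (v i)) ^ ((![7, 5] : Fin 2 → ℕ) i) - (zetaOf (lev (v i)) (F (v i)) ^ ((![7, 5] : Fin 2 → ℕ) i))⁻¹)
    (h8 : ∀ j, lev j = 8 → j = v 0) (h40 : ∀ j, lev j = 40 → j = v 1)
    (hS : IsSplitWeilType ((B 1).prod ((B 0).prod (B 0)))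
      (prodLift (fst (B 1) ((B 0).prod (B 0)) ≫ ιB 1 (a 1))
        (snd (B 1) ((B 0).prod (B 0)) ≫ prodLift (fst (B 0) (B 0) ≫ ιB 0 (a 0)) (snd (B 0) (B 0) ≫ ιB 0 (a 0)))) 3 2)
    {ι : Type} [Fintype ι] (f : ι → κ) {X : AbelianVariety ℂ} (hX : IsIsogenous X (⨁ fun i => C (f i))) : HodgeConjectureFor X.dim X.X :=
  hodgeConjectureFor_of_isIsogenous_prod_forty_of_weilClasses_algebraic hlev hinj hΛ hC hv0 hv1 hind hfin hB hs hst hiso a ha h8 h40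
    (weilClasses_sixfold_algebraic_of_markman_of_isSplitWeilType_prodModel (lev := fun i => lev (v i)) (K := fun i => F (v i))
      (Φ := fun i => Λ (v i)) hM hv0 hv1 (fun i σ => hΛ (v i) σ) hind hfin a ha hB hS) f hX

end Family

end WeightedForty

end HyperellipticJacobian

end Literature.AlgebraicGeometry.ComplexMultiplication

end
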